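import Mathlib
import Summits.MatrixMultiplication.Statement
import Summits.MatrixMultiplication.MatrixMultiplication.Theorems.GraphEquationsFanSpecimen
import Summits.MatrixMultiplication.MatrixMultiplication.Theorems.GraphEquationsDeepDeflation
import Summits.MatrixMultiplication.MatrixMultiplication.Theorems.GraphEquationsDegreeLadderLimit
import Summits.MatrixMultiplication.MatrixMultiplication.Theorems.GraphEquationsInitialIdealRung

/-!
# The kernel-field rung and the one-round kernel-field dial (`GraphEquations`, kernel M76)

Decomp-mm node «GraphEquations» (lens 5: base range + asymptotic regime + bridge); attacked leaf
`MultiplicityReduction` (stmt-MatrixMultiplication-27806); target of the node, VERBATIM: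
`_root_.MatrixMultiplication`.  The route cut `closes (hV : GraphEquationsQuadratic)
(hM : MultiplicityReduction)` is untouched; everything here sits under `hM` via the degree ladder
`MultiplicityReduction ↔ (∀ D ≥ 4, EquationsForceMultiplicationDeg D) ∧ LimitDegreeReduction` (M70).

## 1. The `∃`-form kernel-field rung is the order rung (quantifier settled)

`EqAdmissibleKernelField β K`: for all `n ≥ 1` there are a CORRECT system `E`, a coefficient field
`μ` exposed by a fan-in-two program `E_μ`, `μ` a KERNEL FIELD of `E` (`D_μ t ∈ I`), total cost
`cost E + cost E_μ = O(n^β)`, such that EVERY system containing the `μ`-deflation of `E` has its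
test ideal initially isolated to order `K` over some base pair.  The last clause is stated with
`∀ E', E.DeflatesTo μ E' → …`; `EqSystem.forall_deflatesTo_idealInitIsolatedAt_iff` shows it is the
CANONICAL form — it says exactly that the ideal `(T(E) ∪ D_μ T(E))` is initially isolated, so it does
not depend on which realisation (e.g. the forward-mode AD output, `forwardModeAD`) is taken.
**`eqAdmissibleKernelField_iff : EqAdmissibleKernelField β K ↔ EqAdmissibleIdealIso β K`**
(`→`: deflate by forward-mode AD, the deflation is correct because `μ` is a kernel field;
`←`: the ZERO field, exposed at cost `0`).  Hence the `∃`-rung carries no exponent of its own — it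
is the order rung `K` of M13 in another currency (exactly as `kernelFieldDeflation_iff`, M15c, at
order `1`), and `EqAdmissibleKernelField β 2 → 2 ≤ β → ∀ β' > β, EqAdmissiblePure β'` /
`… → omega ℂ ≤ β` are the order-`2` engine `boundedOrderPurification_two` (sanity checks of the
critic: `(a)` is `EqAdmissibleKernelField.of_eqAdmissibleIdealIso`, `(b)` is
`eqAdmissibleKernelField_of_omega_lt`).

## 2. The content is UNIFORM: the one-round kernel-field dial `KernelFieldClauseDeg D K`

`KernelFieldClauseDeg D K` (KFC): there is `c` such that EVERY correct system `E` with tests of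
degree `≤ D` over `n ≥ 1` admits a kernel field `μ`, exposed by a fan-in-two program of cost
`≤ c·(cost E + n²)`, after whose deflation the test ideal is initially isolated to order `K` over
some base pair.  Results:
* `kernelFieldClauseDeg_of_degreeBoundsIsoOrder : DegreeBoundsIsoOrder D K → KFC D K` (zero field) —
  KFC is WEAKER than the order dial, which is dead from degree `4` on (M71);
* **`efmDeg_of_kernelFieldClauseDeg : KFC D K → K ≤ 2 → EquationsForceMultiplicationDeg D`** and
  `omegaDeg_eq_omega_of_kernelFieldClauseDeg` (`ω_D = ω`); at `K = 1` even at the exact exponent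
  (`eqAdmissiblePure_of_kernelFieldClauseDeg_one`);
* the degree-`4` specimens that killed the order dial SATISFY the clause with `K = 1` over EVERY base
  pair and relative budget `1` (companion kernel M77, `GraphEquationsKernelFieldSpecimens`: rigid
  quadric systems — chains, squares — by a constant field of cost `n²`; the fan by the base-linear
  field `fanField` of cost `3`);
* **upper anatomy** `not_kernelFieldClauseDeg : K + 2 ≤ e → ¬ KFC (2e) K`: the powers `{f_q^e}` are
  sent by ANY single round into `I^(e-1)`, isolated to no order `< e-1` (M14a).  So ONE round is the
  right dial only on the base range `4 ≤ D ≤ 7` (`K = 2`) / `4 ≤ D ≤ 5` (`K = 1`):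
  `¬ KFC 8 2`, `¬ KFC 6 1`; the asymptotic regime `∀ D` needs `⌊D/2⌋ - 2` or more rounds.

`KernelFieldClauseDeg 4 2` (KFC₄) is UNDECIDED: no correct degree-`4` system is known that forces a
kernel field of `(a,b)`-degree `≥ 2` or two successive rounds.  No `sorry`.

Sources: [BurgisserClausenShokrollahi1997, §7.1 (derivative inequality / forward mode), Problem 16.3];
Leykin–Verschelde–Zhao, *Newton's method with deflation for isolated singularities of polynomial
systems*, TCS 359 (2006) 111–122 [doi:10.1016/j.tcs.2006.02.018], Thm 3.1 (one deflation step per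
unit of multiplicity structure — here the number of rounds is tied to the DEGREE, §3 anatomy).
-/

set_option linter.dupNamespace false

noncomputable section

namespace Summit.MatrixMultiplication.MatrixMultiplication.Theorems.GraphEquations

open MvPolynomial Matrix Literature.Computability.AlgebraicComplexity
open Literature.Computability.AlgebraicComplexity.ArithCircuit

variable {n : ℕ}

/-! ## Bookkeeping: order monotonicity, inheritance under deflation, the canonical clause -/

namespace EqSystem

/-- Ideal isolation to order `K` is ideal isolation to every larger order. -/
theorem IdealInitIsolatedAt.mono_order {E : EqSystem n} {K K' : ℕ} {y : MatMulVars n → ℂ}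
    (h : E.IdealInitIsolatedAt K y) (hKK' : K ≤ K') : E.IdealInitIsolatedAt K' y := by
  obtain ⟨T, u, hu, ν, G, hν, hG, hlow, hiso⟩ := h
  exact ⟨T, u, hu, ν, G, fun o => (hν o).trans hKK', hG, hlow, hiso⟩

/-- A system containing a deflation of `E` inherits the ideal isolation of `E` (its ideal is larger). -/
theorem IdealInitIsolatedAt.of_deflatesTo {E E' : EqSystem n}
    {μ : Fin n × Fin n → MvPolynomial (MatMulVars n) ℂ} {K : ℕ} {y : MatMulVars n → ℂ}
    (h : E.IdealInitIsolatedAt K y) (hD : E.DeflatesTo μ E') : E'.IdealInitIsolatedAt K y := by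
  obtain ⟨T, u, hu, hfam⟩ := h
  exact ⟨T, u, fun i => Ideal.span_mono hD.testSet_subset (hu i), hfam⟩

/-- **The clause is canonical.**  "Every system containing the `μ`-deflation of `E` is ideal-isolated to
order `K` over `y`" says exactly that the ideal `(T(E) ∪ D_μ T(E))` is initially isolated to order `K`
over `y` — independently of the realisation. -/
theorem forall_deflatesTo_idealInitIsolatedAt_iff (E : EqSystem n)
    (μ : Fin n × Fin n → MvPolynomial (MatMulVars n) ℂ) (K : ℕ) (y : MatMulVars n → ℂ) :
    (∀ E' : EqSystem n, E.DeflatesTo μ E' → E'.IdealInitIsolatedAt K y) ↔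
      IdealInitIsolatedSet (E.testSet ∪ derivC μ '' E.testSet) K y := by
  classical
  constructor
  · intro h
    obtain ⟨E', -, hto, hfrom⟩ :=
      exists_realisation_list (E.tests.map E.testPoly ++ E.tests.map fun j => derivC μ (E.testPoly j))
    have hD : E.DeflatesTo μ E' :=
      ⟨fun j hj => hfrom (E.testPoly j) (List.mem_append_left _ (List.mem_map.2 ⟨j, hj, rfl⟩)),
        fun j hj => hfrom (derivC μ (E.testPoly j)) (List.mem_append_right _ (List.mem_map.2 ⟨j, hj, rfl⟩))⟩
    obtain ⟨T, u, hu, hfam⟩ := h E' hD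
    refine ⟨T, u, fun i => Ideal.span_mono ?_ (hu i), hfam⟩
    rintro _ ⟨o, rfl⟩
    rcases List.mem_append.1 (hto _ (List.get_mem _ o)) with hm | hm
    · obtain ⟨j, hj, he⟩ := List.mem_map.1 hm
      exact Or.inl ((E.mem_testSet_iff _).2 ⟨j, hj, he⟩)
    · obtain ⟨j, hj, he⟩ := List.mem_map.1 hm
      exact Or.inr ⟨E.testPoly j, (E.mem_testSet_iff _).2 ⟨j, hj, rfl⟩, he⟩
  · rintro ⟨T, u, hu, hfam⟩ E' hD
    refine ⟨T, u, fun i => Ideal.span_mono ?_ (hu i), hfam⟩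
    rintro t (ht | ⟨s, hs, rfl⟩)
    · exact hD.testSet_subset ht
    · exact hD.derivC_mem_testSet s hs

end EqSystem

/-! ## The zero field: exposed at cost `0`, a kernel field of every system -/

/-- `D_0 u = 0`. -/
theorem derivC_zero_field (u : MvPolynomial (GraphVars n) ℂ) :
    derivC (0 : Fin n × Fin n → MvPolynomial (MatMulVars n) ℂ) u = 0 := by
  simp [derivC]

/-- The EMPTY program with one (junk, value `0`) test: it exposes the zero field at cost `0`. -/
def zeroFieldSystem (n : ℕ) : EqSystem n := ⟨⟨[], .const 0⟩, [0]⟩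

/-- The empty program is fan-in two. -/
theorem zeroFieldSystem_isFanInTwo : (zeroFieldSystem n).circuit.IsFanInTwo := by
  intro g hg; simp [zeroFieldSystem] at hg

/-- … of cost `0`. -/
theorem zeroFieldSystem_cost : (zeroFieldSystem n).cost = 0 := by
  simp [zeroFieldSystem, EqSystem.cost, ArithCircuit.size]

/-- … and exposes the zero field. -/
theorem zeroFieldSystem_exposes (q : Fin n × Fin n) :
    ∃ j ∈ (zeroFieldSystem n).tests, (zeroFieldSystem n).testPoly j =
      liftAB n ((0 : Fin n × Fin n → MvPolynomial (MatMulVars n) ℂ) q) :=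
  ⟨0, by simp [zeroFieldSystem], by
    rw [Pi.zero_apply, map_zero]; exact EqSystem.testPoly_eq_zero_of_le zeroFieldSystem_cost.le⟩

/-! ## 1. The `∃`-form kernel-field rung and its collapse onto the order rung -/

/-- **`EqAdmissibleKernelField β K`** (`∃`-form kernel-field rung of target order `K`): for all `n ≥ 1`
there are a correct system `E`, a field `μ` exposed by a fan-in-two program `E_μ`, with `μ` a KERNEL
FIELD of `E`, total cost `O(n^β)`, such that every system containing the `μ`-deflation of `E` has its
test ideal initially isolated to order `K` over some base pair. -/
def EqAdmissibleKernelField (β : ℝ) (K : ℕ) : Prop :=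
  ∃ c : ℝ, ∀ n : ℕ, 1 ≤ n →
    ∃ (E Eμ : EqSystem n) (μ : Fin n × Fin n → MvPolynomial (MatMulVars n) ℂ),
      E.Correct ∧ Eμ.circuit.IsFanInTwo ∧ (∀ q, ∃ j ∈ Eμ.tests, Eμ.testPoly j = liftAB n (μ q)) ∧
      (∀ j ∈ E.tests, derivC μ (E.testPoly j) ∈ graphIdeal n) ∧
      (E.cost : ℝ) + Eμ.cost ≤ c * (n : ℝ) ^ β ∧
      ∀ E' : EqSystem n, E.DeflatesTo μ E' → ∃ y, E'.IdealInitIsolatedAt K y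

/-- `→`: deflate by forward-mode AD (cost `≤ 4·cost E + cost E_μ`); the deflation is CORRECT because `μ`
is a kernel field, and ideal-isolated to order `K` by the clause. -/
theorem EqAdmissibleKernelField.eqAdmissibleIdealIso {β : ℝ} {K : ℕ} (h : EqAdmissibleKernelField β K) :
    EqAdmissibleIdealIso β K := by
  obtain ⟨c, hc⟩ := h
  refine ⟨4 * c, fun n hn => ?_⟩
  obtain ⟨E, Eμ, μ, hE, hfanμ, hμ, hKF, hcost, hgood⟩ := hc n hn
  obtain ⟨E', hfan', hD, hshape, hcost'⟩ := forwardModeAD n E Eμ μ hE.1 hfanμ hμ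
  refine ⟨E', hE.of_deflatesTo hfan' hD hshape hKF, hgood E' hD, ?_⟩
  have h3 : (E'.cost : ℝ) ≤ 4 * E.cost + Eμ.cost := by exact_mod_cast hcost'
  have h0 : (0 : ℝ) ≤ Eμ.cost := Nat.cast_nonneg _
  linarith

/-- `←` (critic's sanity check (a)): the ZERO field, exposed at cost `0`, is a kernel field whose
"deflation" only enlarges the test ideal. -/
theorem EqAdmissibleKernelField.of_eqAdmissibleIdealIso {β : ℝ} {K : ℕ} (h : EqAdmissibleIdealIso β K) :
    EqAdmissibleKernelField β K := by
  obtain ⟨c, hc⟩ := h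
  refine ⟨c, fun n hn => ?_⟩
  obtain ⟨E, hE, ⟨y, hy⟩, hcost⟩ := hc n hn
  refine ⟨E, zeroFieldSystem n, 0, hE, zeroFieldSystem_isFanInTwo, zeroFieldSystem_exposes,
    fun j _ => by rw [derivC_zero_field]; exact Ideal.zero_mem _, ?_,
    fun E' hD => ⟨y, hy.of_deflatesTo hD⟩⟩
  rw [zeroFieldSystem_cost, Nat.cast_zero, add_zero]; exact hcost

/-- **The `∃`-form kernel-field rung IS the order rung**: `EqAdmissibleKernelField β K ↔ EqAdmissibleIdealIso β K`. -/
theorem eqAdmissibleKernelField_iff {β : ℝ} {K : ℕ} :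
    EqAdmissibleKernelField β K ↔ EqAdmissibleIdealIso β K :=
  ⟨EqAdmissibleKernelField.eqAdmissibleIdealIso, EqAdmissibleKernelField.of_eqAdmissibleIdealIso⟩

/-- Target order `1`: pure systems at the SAME exponent (BOP′(1), M13c). -/
theorem EqAdmissibleKernelField.eqAdmissiblePure_one {β : ℝ} (h : EqAdmissibleKernelField β 1) {β' : ℝ}
    (hββ' : β ≤ β') : EqAdmissiblePure β' :=
  boundedOrderPurification_one h.eqAdmissibleIdealIso hββ'

/-- Target order `≤ 2`: pure systems at every larger exponent (BOP(2), M47). -/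
theorem EqAdmissibleKernelField.eqAdmissiblePure_of_lt {β : ℝ} {K : ℕ} (h : EqAdmissibleKernelField β K)
    (hK : K ≤ 2) (hβ : 2 ≤ β) {β' : ℝ} (hββ' : β < β') : EqAdmissiblePure β' :=
  boundedOrderPurification_two β hβ (h.eqAdmissibleIdealIso.mono_order hK) β' hββ'

/-- **`EqAdmissibleKernelField β K → ω ≤ β`** for `K ≤ 2 ≤ β`. -/
theorem EqAdmissibleKernelField.omega_le {β : ℝ} {K : ℕ} (h : EqAdmissibleKernelField β K) (hK : K ≤ 2)
    (hβ : 2 ≤ β) : omega ℂ ≤ β :=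
  le_of_forall_gt_imp_ge_of_dense fun _ hβ' => (h.eqAdmissiblePure_of_lt hK hβ hβ').omega_le

/-- NEC (critic's sanity check (b)): `ω < β → EqAdmissibleKernelField β K` for every `K ≥ 1`. -/
theorem eqAdmissibleKernelField_of_omega_lt {β : ℝ} (hβ : omega ℂ < β) {K : ℕ} (hK : 1 ≤ K) :
    EqAdmissibleKernelField β K :=
  .of_eqAdmissibleIdealIso ((eqAdmissibleIdealIso_one_of_omega_lt hβ).mono_order hK)

/-! ## 2. The one-round kernel-field dial `KernelFieldClauseDeg D K` -/

/-- **`KernelFieldClauseDeg D K`** (KFC · UNDECIDED at `(4, 2)`, `(4, 1)`): there is `c` such that every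
correct system `E` with tests of degree `≤ D` over `n ≥ 1` admits a KERNEL FIELD `μ`, exposed by a
fan-in-two program of cost `≤ c·(cost E + n²)`, such that every system containing the `μ`-deflation
of `E` has its test ideal initially isolated to order `K` over some base pair.  Refutable by ONE
specimen family; `μ = 0` allowed (then it is order-`K` isolation of `E` itself). -/
def KernelFieldClauseDeg (D K : ℕ) : Prop :=
  ∃ c : ℕ, ∀ n : ℕ, 1 ≤ n → ∀ E : EqSystem n, E.Correct → E.IsDegLe D →
    ∃ (μ : Fin n × Fin n → MvPolynomial (MatMulVars n) ℂ) (Eμ : EqSystem n),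
      Eμ.circuit.IsFanInTwo ∧ (∀ q, ∃ j ∈ Eμ.tests, Eμ.testPoly j = liftAB n (μ q)) ∧
      (∀ j ∈ E.tests, derivC μ (E.testPoly j) ∈ graphIdeal n) ∧
      Eμ.cost ≤ c * (E.cost + n * n) ∧
      ∀ E' : EqSystem n, E.DeflatesTo μ E' → ∃ y, E'.IdealInitIsolatedAt K y

/-- Antitone in the degree. -/
theorem KernelFieldClauseDeg.anti_deg {D D' K : ℕ} (h : KernelFieldClauseDeg D' K) (hDD' : D ≤ D') :
    KernelFieldClauseDeg D K := by
  obtain ⟨c, hc⟩ := h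
  exact ⟨c, fun n hn E hE hD => hc n hn E hE (hD.mono hDD')⟩

/-- Monotone in the target order. -/
theorem KernelFieldClauseDeg.mono_order {D K K' : ℕ} (h : KernelFieldClauseDeg D K) (hKK' : K ≤ K') :
    KernelFieldClauseDeg D K' := by
  obtain ⟨c, hc⟩ := h
  refine ⟨c, fun n hn E hE hD => ?_⟩
  obtain ⟨μ, Eμ, hfan, hμ, hKF, hcost, hgood⟩ := hc n hn E hE hD
  exact ⟨μ, Eμ, hfan, hμ, hKF, hcost, fun E' hD' => (hgood E' hD').imp fun y hy => hy.mono_order hKK'⟩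

/-- **The order dial implies the kernel-field dial** (zero field): KFC is the weaker dial. -/
theorem kernelFieldClauseDeg_of_degreeBoundsIsoOrder {D K : ℕ} (h : DegreeBoundsIsoOrder D K) :
    KernelFieldClauseDeg D K :=
  ⟨0, fun n hn E hE hD => ⟨0, zeroFieldSystem n, zeroFieldSystem_isFanInTwo, zeroFieldSystem_exposes,
    fun j _ => by rw [derivC_zero_field]; exact Ideal.zero_mem _,
    by rw [zeroFieldSystem_cost]; exact Nat.zero_le _,
    fun E' hD' => (h n hn E hE hD).imp fun y hy => hy.of_deflatesTo hD'⟩⟩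

/-- KFC turns degree-`D` admissibility into the kernel-field rung at the same exponent `β ≥ 2`. -/
theorem KernelFieldClauseDeg.eqAdmissibleKernelField {D K : ℕ} (h : KernelFieldClauseDeg D K) {β : ℝ}
    (hβ : 2 ≤ β) (hA : EqAdmissibleDeg D β) : EqAdmissibleKernelField β K := by
  obtain ⟨c, hc⟩ := h
  obtain ⟨c₀, hc₀⟩ := hA
  refine ⟨max c₀ 0 + c * (max c₀ 0 + 1), fun n hn => ?_⟩
  obtain ⟨E, hE, hD, hcost⟩ := hc₀ n hn
  obtain ⟨μ, Eμ, hfan, hμ, hKF, hμcost, hgood⟩ := hc n hn E hE hD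
  refine ⟨E, Eμ, μ, hE, hfan, hμ, hKF, ?_, hgood⟩
  have hn1 : (1 : ℝ) ≤ n := by exact_mod_cast hn
  have hpos : 0 ≤ (n : ℝ) ^ β := Real.rpow_nonneg (Nat.cast_nonneg n) β
  have hsq : (n : ℝ) * n ≤ (n : ℝ) ^ β := by
    rw [← pow_two, ← Real.rpow_natCast]
    exact Real.rpow_le_rpow_of_exponent_le hn1 (by exact_mod_cast hβ)
  have h1 : (E.cost : ℝ) ≤ max c₀ 0 * (n : ℝ) ^ β :=
    hcost.trans (mul_le_mul_of_nonneg_right (le_max_left c₀ 0) hpos)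
  have h2 : (Eμ.cost : ℝ) ≤ c * (E.cost + n * n) := by exact_mod_cast hμcost
  have hc0 : (0 : ℝ) ≤ c := Nat.cast_nonneg c
  nlinarith [mul_nonneg hc0 (sub_nonneg.2 hsq), mul_nonneg hc0 (sub_nonneg.2 h1), le_max_right c₀ 0]

/-- **KFC_D ⇒ EFM_D** (`[ω_D = ω]`) for target orders `K ≤ 2`: the order-`2` purification engine. -/
theorem efmDeg_of_kernelFieldClauseDeg {D K : ℕ} (h : KernelFieldClauseDeg D K) (hK : K ≤ 2) :
    EquationsForceMultiplicationDeg D :=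
  fun _ hβ hA => (h.eqAdmissibleKernelField hβ hA).omega_le hK hβ

/-- The same in dial currency: `ω_D = ω`. -/
theorem omegaDeg_eq_omega_of_kernelFieldClauseDeg {D K : ℕ} (hD : 2 ≤ D) (h : KernelFieldClauseDeg D K)
    (hK : K ≤ 2) : omegaDeg D = omega ℂ :=
  (efmDeg_iff_omegaDeg_eq hD).mp (efmDeg_of_kernelFieldClauseDeg h hK)

/-- At target order `1` the purified exponent is EXACT (no density argument). -/
theorem eqAdmissiblePure_of_kernelFieldClauseDeg_one {D : ℕ} (h : KernelFieldClauseDeg D 1) {β : ℝ}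
    (hβ : 2 ≤ β) (hA : EqAdmissibleDeg D β) : EqAdmissiblePure β :=
  (h.eqAdmissibleKernelField hβ hA).eqAdmissiblePure_one le_rfl

/-! ## 3. Upper anatomy: one round is the right dial only on a bounded degree range -/

/-- The POWER SYSTEM `{f_q^e}` (`e ≥ 1`) realised: correct, of degree `≤ 2e`, with tests in `I^e`. -/
theorem exists_powerSystem {e : ℕ} (he : 1 ≤ e) :
    ∃ E : EqSystem n, E.Correct ∧ E.IsDegLe (2 * e) ∧ ∀ j ∈ E.tests, E.testPoly j ∈ graphIdeal n ^ e := by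
  classical
  obtain ⟨E, hfan, hto, hfrom⟩ :=
    exists_realisation_list ((Finset.univ : Finset (Fin n × Fin n)).toList.map fun q => generator n q ^ e)
  have hto' : ∀ j ∈ E.tests, ∃ q, E.testPoly j = generator n q ^ e := fun j hj => by
    obtain ⟨q, -, hq⟩ := List.mem_map.1 (hto j hj)
    exact ⟨q, hq.symm⟩
  have hfrom' : ∀ q, ∃ j ∈ E.tests, E.testPoly j = generator n q ^ e := fun q =>
    hfrom _ (List.mem_map.2 ⟨q, Finset.mem_toList.2 (Finset.mem_univ q), rfl⟩)
  refine ⟨E, ⟨hfan, Set.ext fun x => ⟨fun hx => ?_, fun hx j hj => ?_⟩⟩, fun o => ?_, fun j hj => ?_⟩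
  · refine (mem_mmGraph_iff_eval_generator x).2 fun q => ?_
    obtain ⟨j, hj, hjq⟩ := hfrom' q
    have h := hx j hj
    rw [hjq, map_pow] at h
    exact (pow_eq_zero_iff (by omega)).1 h
  · obtain ⟨q, hq⟩ := hto' j hj
    rw [hq, map_pow, (mem_mmGraph_iff_eval_generator x).1 hx q, zero_pow (by omega)]
  · obtain ⟨q, hq⟩ := hto' _ (List.get_mem _ o)
    rw [hq]
    have hg := totalDegree_generator_le_two n q
    exact (totalDegree_pow _ _).trans (by nlinarith)
  · obtain ⟨q, hq⟩ := hto' j hj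
    rw [hq]; exact Ideal.pow_mem_pow (generator_mem_graphIdeal q) e

/-- **UPPER ANATOMY OF THE ONE-ROUND DIAL.**  Any single kernel-field round sends the power system
`{f_q^e}` (degree `2e`) to a system with tests in `I^(e-1)`, which is ideal-isolated to NO order
`< e - 1` over any base pair (M14a): `KernelFieldClauseDeg (2e) K` fails whenever `K + 2 ≤ e`. -/
theorem not_kernelFieldClauseDeg {K e : ℕ} (hKe : K + 2 ≤ e) : ¬ KernelFieldClauseDeg (2 * e) K := by
  obtain ⟨d, rfl⟩ : ∃ d, e = d + 2 := ⟨e - 2, by omega⟩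
  rintro ⟨c, hc⟩
  obtain ⟨E, hE, hdeg, hpow⟩ := exists_powerSystem (n := 1) (e := d + 2) (by omega)
  obtain ⟨μ, Eμ, hfanμ, hμ, -, -, hgood⟩ := hc 1 le_rfl E hE hdeg
  obtain ⟨E', -, hD, hshape, -⟩ := forwardModeAD 1 E Eμ μ hE.1 hfanμ hμ
  refine not_exists_idealInitIsolatedAt_of_tests_mem_pow le_rfl (show K < d + 1 by omega)
    (fun o => ?_) (hgood E' hD)
  rcases hshape _ (List.get_mem _ o) with ⟨j, hj, he⟩ | ⟨j, hj, he⟩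
  · rw [he]; exact Ideal.pow_le_pow_right (by omega) (hpow j hj)
  · rw [he]; exact derivC_mem_pow_of_mem_pow_succ μ _ (d + 1) (hpow j hj)

/-- `K = 2`: one round cannot be the dial from degree `8` on … -/
theorem not_kernelFieldClauseDeg_eight_two : ¬ KernelFieldClauseDeg 8 2 :=
  not_kernelFieldClauseDeg (K := 2) (e := 4) le_rfl

/-- … and for `K = 1` from degree `6` on: the one-round dials live on `4 ≤ D ≤ 7` resp. `4 ≤ D ≤ 5`. -/
theorem not_kernelFieldClauseDeg_six_one : ¬ KernelFieldClauseDeg 6 1 :=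
  not_kernelFieldClauseDeg (K := 1) (e := 3) le_rfl

/-- **SUMMARY (the degree-`4` rung in kernel-field currency).**  `DegreeBoundsIsoOrder 4 K` is false for
every `K` (M71), yet its kernel-field weakening decides the rung: `KernelFieldClauseDeg 4 K → ω₄ = ω`
for `K ≤ 2`, and the clause holds on the rigid quadric class and on the fan. -/
theorem degree_four_kernelField_summary :
    (∀ K, ¬ DegreeBoundsIsoOrder 4 K) ∧
    (∀ K ≤ 2, KernelFieldClauseDeg 4 K → omegaDeg 4 = omega ℂ) ∧
    (∀ K ≤ 2, KernelFieldClauseDeg 4 K → EquationsForceMultiplicationDeg 4) :=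
  ⟨not_degreeBoundsIsoOrder_four, fun _ hK h => omegaDeg_eq_omega_of_kernelFieldClauseDeg (by norm_num) h hK,
    fun _ hK h => efmDeg_of_kernelFieldClauseDeg h hK⟩

end Summit.MatrixMultiplication.MatrixMultiplication.Theorems.GraphEquations

end
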